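/-
Copyright: the b2b-balaban T⁴-continuum CRUX team, row NE7b OWNER lineage `t4-ne7b-p1` (gen 143). Project licence.
-/
import Summits.QuantumFields.BalabanUV.T4Continuum.Spine.NE7b.SupWhitenedThirdGradGradCumulantRaw

/-!
# THE ORDER-5 BRIDGES FROM THE WHITENED LAW TO `N(0,AAᵀ)` (SCOPING (d14)(2)(vi), bookkeeping; the order-5 analogue of (522) §2).  The fifth
# cumulant's row letter (560) and the mixed fourth cumulant's row letters (576) are stated under the whitened tilted law `ν` on `ℝ^κ`; the
# assembly of `∂⁵W`'s kernel letter reads them in the tilted Gaussian format `Z⁻¹∫e^{−U(ω+ψ)}(⋯)dN(0,AAᵀ)(ω)`.  Every such bridge is ONE instance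
# of (566)'s generic `whitened_observable_bridge`; here the five shapes the order-5 pieces need beyond (475)∕(478)∕(508)∕(522)'s: the QUINTUPLE of
# gradient factors, the Hessian–gradient and gradient–Hessian PAIRS, the mixed QUADRUPLES with the Hessian entry first or second — for arbitrary
# centring constants (row NE7b, node U5c; (566) `whitened_observable_bridge` BY NAME; [folklore])

Cell `pub-balaban`, sub-cell `t4`, spine estimate NE7b (`T4WeightBudget.RelWeightBound`; the cell's OWN estimate — NOT PRINTED in
[Bałaban 1983–89], NOT PROVED).  Crux-route work under `Spine/NE7b/` by the row OWNER (`t4-ne7b-p1` gen 143, file (577)) under FREEZE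
(0)'s crux-prover clause; NOTHING of Bałaban's is named as a Lean object, valued or asserted; no `T4Continuum/Support` leaf typed; no
`def`, no notation; zero `sorry`.  Imports (BY NAME): the OWNER's (566) `…SupWhitenedThirdGradGradCumulantRaw` (`whitened_observable_bridge`).

WHAT IS PROVED ([folklore]): **`whitened_quint_bridge`**, **`whitened_hess_pair_bridge`**, **`whitened_grad_hess_pair_bridge`**,
**`whitened_hess_quad_bridge`**, **`whitened_grad_hess_quad_bridge`**; toy.

HONEST (what this is NOT).  Measure bookkeeping only; the tilted-format row letters are the next files; the FORM of `∂⁵W` and the assembly are NOT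
typed.  Scalar skeleton ((A3), NC-NE7b-α UNRULED); nothing of Bałaban's asserted.  BY-NAME EFFECT ON THE WALL: NONE.  NE7b NOT PRINTED ∕ NOT
PROVED; spine PROVED 0∕9; rung (B)+1 — the programme's measures remain FINITE-torus statements; NOT the mass gap, NOT Clay.  HONEST DEPENDENCY:
continuum YM on T⁴ ⇐ BetaPertH ∧ nine spine estimates (0∕9 proved); BetaPertH ⇐ (D1) ∧ (D4) ∧ CAP+tail; G-an2-4 gates asym, D1 and NE2∕3∕4.
-/

set_option autoImplicit false
set_option maxSynthPendingDepth 2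

noncomputable section

namespace Summit.QuantumFields.BalabanUV.T4Continuum.NE7b.SupWhitenedFifthKernelBridges

open MeasureTheory ProbabilityTheory Real Set Function Finset Matrix
open scoped BigOperators
open Literature.Probability.Distributions (matrixCLM)
open SupWhitenedThirdGradGradCumulantRaw (whitened_observable_bridge)

variable {ι κ : Type} [Fintype ι] [DecidableEq ι] [Fintype κ] [DecidableEq κ]

variable {U : EuclideanSpace ℝ ι → ℝ} {U' : EuclideanSpace ℝ ι → EuclideanSpace ℝ ι →L[ℝ] ℝ}
  {U'' : EuclideanSpace ℝ ι → EuclideanSpace ℝ ι →L[ℝ] EuclideanSpace ℝ ι →L[ℝ] ℝ}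

/-- **The quintuple bridge**: `E_νΠ_{i=1}^5(F_{v_i}−c_i) = Z⁻¹∫e^{−U}Π_{i=1}^5(U′(ω+ψ)v_i−c_i) dN(0,AAᵀ)`. [folklore] -/
theorem whitened_quint_bridge (hUc : Continuous U) (hU'c : Continuous U') (A : Matrix ι κ ℝ) (ψ v₁ v₂ v₃ v₄ v₅ : EuclideanSpace ℝ ι) (c₁ c₂ c₃ c₄ c₅
    : ℝ) :
    ∫ w, (U' (matrixCLM A (WithLp.toLp 2 w) + ψ) v₁ - c₁) * (U' (matrixCLM A (WithLp.toLp 2 w) + ψ) v₂ - c₂) * (U' (matrixCLM A (WithLp.toLp 2 w) +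
        ψ) v₃ - c₃) * (U' (matrixCLM A (WithLp.toLp 2 w) + ψ) v₄ - c₄) * (U' (matrixCLM A (WithLp.toLp 2 w) + ψ) v₅ - c₅) ∂((volume : Measure (κ →
        ℝ)).tilted fun z => -(1 / 2 * (z ⬝ᵥ z) + U (matrixCLM A (WithLp.toLp 2 z) + ψ))) =
      (∫ ω : EuclideanSpace ℝ ι, exp (-U (ω + ψ)) ∂(multivariateGaussian 0 (A * Aᵀ)))⁻¹ * (∫ ω : EuclideanSpace ℝ ι, exp (-U (ω + ψ)) *
        ((U' (ω + ψ) v₁ - c₁) * (U' (ω + ψ) v₂ - c₂) * (U' (ω + ψ) v₃ - c₃) * (U' (ω + ψ) v₄ - c₄) * (U' (ω + ψ) v₅ - c₅)) ∂(multivariateGaussian 0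
            (A * Aᵀ))) :=
  whitened_observable_bridge (U := U) hUc A ψ (p := fun φ => (U' φ v₁ - c₁) * (U' φ v₂ - c₂) * (U' φ v₃ - c₃) * (U' φ v₄ - c₄) * (U' φ v₅ - c₅))
    ((((((hU'c.clm_apply continuous_const).sub continuous_const).mul ((hU'c.clm_apply continuous_const).sub continuous_const)).mul ((hU'c.clm_apply
        continuous_const).sub continuous_const)).mul ((hU'c.clm_apply continuous_const).sub continuous_const)).mul ((hU'c.clm_apply
        continuous_const).sub continuous_const))

/-- **The Hessian–gradient pair bridge**: `E_ν(G_{xy}−c₁)(F_v−c₂)` in the Gaussian format. [folklore] -/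
theorem whitened_hess_pair_bridge (hUc : Continuous U) (hU'c : Continuous U') (hU''c : Continuous U'') (A : Matrix ι κ ℝ) (ψ : EuclideanSpace ℝ ι) (x
    y : ι) (v : EuclideanSpace ℝ ι) (c₁ c₂ : ℝ) :
    ∫ w, (U'' (matrixCLM A (WithLp.toLp 2 w) + ψ) (EuclideanSpace.single x (1 : ℝ)) (EuclideanSpace.single y (1 : ℝ)) - c₁) * (U' (matrixCLM A
        (WithLp.toLp 2 w) + ψ) v - c₂) ∂((volume : Measure (κ → ℝ)).tilted fun z => -(1 / 2 * (z ⬝ᵥ z) + U (matrixCLM A (WithLp.toLp 2 z) + ψ))) =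
      (∫ ω : EuclideanSpace ℝ ι, exp (-U (ω + ψ)) ∂(multivariateGaussian 0 (A * Aᵀ)))⁻¹ * (∫ ω : EuclideanSpace ℝ ι, exp (-U (ω + ψ)) *
        ((U'' (ω + ψ) (EuclideanSpace.single x (1 : ℝ)) (EuclideanSpace.single y (1 : ℝ)) - c₁) * (U' (ω + ψ) v - c₂)) ∂(multivariateGaussian 0 (A *
            Aᵀ))) :=
  whitened_observable_bridge (U := U) hUc A ψ (p := fun φ => (U'' φ (EuclideanSpace.single x (1 : ℝ)) (EuclideanSpace.single y (1 : ℝ)) - c₁) * (U' φ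
      v - c₂))
    ((((hU''c.clm_apply continuous_const).clm_apply continuous_const).sub continuous_const).mul ((hU'c.clm_apply continuous_const).sub
        continuous_const))

/-- **The gradient–Hessian pair bridge**: `E_ν(F_v−c₁)(G_{xy}−c₂)` in the Gaussian format. [folklore] -/
theorem whitened_grad_hess_pair_bridge (hUc : Continuous U) (hU'c : Continuous U') (hU''c : Continuous U'') (A : Matrix ι κ ℝ) (ψ : EuclideanSpace ℝ
    ι) (v : EuclideanSpace ℝ ι) (x y : ι) (c₁ c₂ : ℝ) :
    ∫ w, (U' (matrixCLM A (WithLp.toLp 2 w) + ψ) v - c₁) * (U'' (matrixCLM A (WithLp.toLp 2 w) + ψ) (EuclideanSpace.single x (1 : ℝ))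
        (EuclideanSpace.single y (1 : ℝ)) - c₂) ∂((volume : Measure (κ → ℝ)).tilted fun z => -(1 / 2 * (z ⬝ᵥ z) + U (matrixCLM A (WithLp.toLp 2 z) +
        ψ))) =
      (∫ ω : EuclideanSpace ℝ ι, exp (-U (ω + ψ)) ∂(multivariateGaussian 0 (A * Aᵀ)))⁻¹ * (∫ ω : EuclideanSpace ℝ ι, exp (-U (ω + ψ)) *
        ((U' (ω + ψ) v - c₁) * (U'' (ω + ψ) (EuclideanSpace.single x (1 : ℝ)) (EuclideanSpace.single y (1 : ℝ)) - c₂)) ∂(multivariateGaussian 0 (A *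
            Aᵀ))) :=
  whitened_observable_bridge (U := U) hUc A ψ (p := fun φ => (U' φ v - c₁) * (U'' φ (EuclideanSpace.single x (1 : ℝ)) (EuclideanSpace.single y (1 :
      ℝ)) - c₂))
    (((hU'c.clm_apply continuous_const).sub continuous_const).mul (((hU''c.clm_apply continuous_const).clm_apply continuous_const).sub
        continuous_const))

/-- **The mixed quadruple bridge, Hessian first**: `E_ν(G_{xy}−c₁)(F_{v₂}−c₂)(F_{v₃}−c₃)(F_{v₄}−c₄)` in the Gaussian format. [folklore] -/
theorem whitened_hess_quad_bridge (hUc : Continuous U) (hU'c : Continuous U') (hU''c : Continuous U'') (A : Matrix ι κ ℝ) (ψ : EuclideanSpace ℝ ι) (x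
    y : ι) (v₂ v₃ v₄ : EuclideanSpace ℝ ι)
    (c₁ c₂ c₃ c₄ : ℝ) :
    ∫ w, (U'' (matrixCLM A (WithLp.toLp 2 w) + ψ) (EuclideanSpace.single x (1 : ℝ)) (EuclideanSpace.single y (1 : ℝ)) - c₁) * (U' (matrixCLM A
        (WithLp.toLp 2 w) + ψ) v₂ - c₂) * (U' (matrixCLM A (WithLp.toLp 2 w) + ψ) v₃ - c₃) * (U' (matrixCLM A (WithLp.toLp 2 w) + ψ) v₄ - c₄)
        ∂((volume : Measure (κ → ℝ)).tilted fun z => -(1 / 2 * (z ⬝ᵥ z) + U (matrixCLM A (WithLp.toLp 2 z) + ψ))) =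
      (∫ ω : EuclideanSpace ℝ ι, exp (-U (ω + ψ)) ∂(multivariateGaussian 0 (A * Aᵀ)))⁻¹ * (∫ ω : EuclideanSpace ℝ ι, exp (-U (ω + ψ)) *
        ((U'' (ω + ψ) (EuclideanSpace.single x (1 : ℝ)) (EuclideanSpace.single y (1 : ℝ)) - c₁) * (U' (ω + ψ) v₂ - c₂) * (U' (ω + ψ) v₃ - c₃) * (U'
            (ω + ψ) v₄ - c₄)) ∂(multivariateGaussian 0 (A * Aᵀ))) :=
  whitened_observable_bridge (U := U) hUc A ψ (p := fun φ => (U'' φ (EuclideanSpace.single x (1 : ℝ)) (EuclideanSpace.single y (1 : ℝ)) - c₁) * (U' φ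
      v₂ - c₂) * (U' φ v₃ - c₃) * (U' φ v₄ - c₄))
    ((((((hU''c.clm_apply continuous_const).clm_apply continuous_const).sub continuous_const).mul ((hU'c.clm_apply continuous_const).sub
        continuous_const)).mul ((hU'c.clm_apply continuous_const).sub continuous_const)).mul ((hU'c.clm_apply continuous_const).sub continuous_const))

/-- **The mixed quadruple bridge, Hessian second**: `E_ν(F_{v₁}−c₁)(G_{xy}−c₂)(F_{v₃}−c₃)(F_{v₄}−c₄)` in the Gaussian format. [folklore] -/
theorem whitened_grad_hess_quad_bridge (hUc : Continuous U) (hU'c : Continuous U') (hU''c : Continuous U'') (A : Matrix ι κ ℝ) (ψ : EuclideanSpace ℝ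
    ι) (v₁ : EuclideanSpace ℝ ι) (x y : ι) (v₃ v₄ : EuclideanSpace ℝ ι)
    (c₁ c₂ c₃ c₄ : ℝ) :
    ∫ w, (U' (matrixCLM A (WithLp.toLp 2 w) + ψ) v₁ - c₁) * (U'' (matrixCLM A (WithLp.toLp 2 w) + ψ) (EuclideanSpace.single x (1 : ℝ))
        (EuclideanSpace.single y (1 : ℝ)) - c₂) * (U' (matrixCLM A (WithLp.toLp 2 w) + ψ) v₃ - c₃) * (U' (matrixCLM A (WithLp.toLp 2 w) + ψ) v₄ - c₄)
        ∂((volume : Measure (κ → ℝ)).tilted fun z => -(1 / 2 * (z ⬝ᵥ z) + U (matrixCLM A (WithLp.toLp 2 z) + ψ))) =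
      (∫ ω : EuclideanSpace ℝ ι, exp (-U (ω + ψ)) ∂(multivariateGaussian 0 (A * Aᵀ)))⁻¹ * (∫ ω : EuclideanSpace ℝ ι, exp (-U (ω + ψ)) *
        ((U' (ω + ψ) v₁ - c₁) * (U'' (ω + ψ) (EuclideanSpace.single x (1 : ℝ)) (EuclideanSpace.single y (1 : ℝ)) - c₂) * (U' (ω + ψ) v₃ - c₃) * (U'
            (ω + ψ) v₄ - c₄)) ∂(multivariateGaussian 0 (A * Aᵀ))) :=
  whitened_observable_bridge (U := U) hUc A ψ (p := fun φ => (U' φ v₁ - c₁) * (U'' φ (EuclideanSpace.single x (1 : ℝ)) (EuclideanSpace.single y (1 :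
      ℝ)) - c₂) * (U' φ v₃ - c₃) * (U' φ v₄ - c₄))
    (((((hU'c.clm_apply continuous_const).sub continuous_const).mul (((hU''c.clm_apply continuous_const).clm_apply continuous_const).sub
        continuous_const)).mul ((hU'c.clm_apply continuous_const).sub continuous_const)).mul ((hU'c.clm_apply continuous_const).sub continuous_const))

/-! ## Toy -/

/-- Toy (a product of differences is continuous in each factor's constant): `(1 − 0)·(1 − 0) = 1`. -/
example : ((1 : ℝ) - 0) * (1 - 0) = 1 := by norm_num

end Summit.QuantumFields.BalabanUV.T4Continuum.NE7b.SupWhitenedFifthKernelBridges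

end
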